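import Mathlib
import HarnessLib
import Summits.HubbardSuperconductivity.HubbardSuperconductivity.Theorems.KLProgrammeKLRegimeEngineTowerDoorToKit
import Summits.HubbardSuperconductivity.HubbardSuperconductivity.Theorems.KLProgrammeKLRegimeEngineTowerScalingLip

/-!
# Route `KLProgramme` — crux K3 ENGINE (stmt-HubbardSuperconductivity-20437 `KLRegimeEngineV17F2`), stub (e) rows C1/C2 «(e)-C ⇐ (b)-TWOVOL»:
# the LIPSCHITZ door → kit DICTIONARY — the Hstep-Lip doors' mixed graded bracket is dominated by T2-Lip's step right side
# (cell gate-hubbard-kl, seat hubbard-kl-k3c5-p2 g9; the polarised twin of E1's (I1-dim) first brick `…EngineTowerDoorToKit` p579248, same dictionary)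

The two-input plateau doors (`Literature/…/SectorisedIncrementBoundGradedLipschitz{,Prescribed}Plateau`, p572336 / p573833) bound the orders `≥ 2` of the DIFFERENCE of the
increments of two inputs across one block by `cr·cc^m·[Σ_{n∈Ico 2 N₀} ρ^{-(m+1)} κ^{-2(n−1)} α^{n−1} eⁿ · Σ_{δ∈[0,D_Γ]^n, m+1+2(n−1) ≤ Σ2δ} Σ_a g_ν(δ_a)·Π_{b≠a} g_μ(δ_b)
+ 2·tail(normV μ̄)]`, `g_ν(d) = (e²(κ+ρ))^{2d} ν̄(d)`; E1's Lipschitz tower (`towerLipStep_le_of_chernoff` p559494, `towerBornDiff_le_law₄`) consumes the step hypothesis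
`Σ_{n∈Icc 2 N} e·Φ^{n−1}·ψ^p·towerSLip D τ ν μ n p + Ct·(ψ^p·e·towerV D τ μ·(Φ·towerV)^N/(1−Φ·towerV))`.  Under E1's dictionary (…TowerDoorToKit, blueprint v5 §9:
`N := N₀ − 1`, `ψ := ρ⁻²`, `Φ := eα/κ²`, `τ := (e²(κ+ρ))²`, degree-`0` sizes `0`, any `D ≥ D_Γ`) and with **`Ct := 2`**:

* **`doorGradedLip_le_kitStepLip`** — the Lipschitz door's bracket (mixed graded sum + `2·`tail) `≤` T2-Lip's (mixed graded sum + `2·`tail) under the kit's guard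
  `Φ·towerV D τ μ̄ < 1`; the mixed graded terms are EQUAL order by order (my glue `sum_range_filter_sum_pow_two_mul_eq_towerSLip`, p562385), only the tail loses one
  `e` per degree (`normV_le_towerV`, `geomTail_mono` of E1's brick).
The first order of the difference is the ONE-input binomial door at the difference profile, so its dictionary is E1's `doorBinomial_le_towerFO` verbatim (no twin).
Pure real analysis; nothing about the model is asserted.  NOT here: units (E1 `…TowerKitUnits` applies slot-wise: `towerSLip_pow_mul`), the model objects.
-/

noncomputable section

namespace Summit.HubbardSuperconductivity.HubbardSuperconductivity.Theorems.EngineV8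

set_option linter.dupNamespace false -- summit = problem name (single-conjunct summit), D-0017

open Real Finset Literature.MathematicalPhysics.QuantumLattice

/-- **THE LIPSCHITZ DOOR'S BRACKET IS DOMINATED BY T2-Lip's STEP RIGHT SIDE.**  Data: `κ, ρ > 0`, `α ≥ 0`; a common majorant profile `μ̄ ≥ 0` and a
difference profile `ν̄ ≥ 0` on the label type `Γ`, both with degree-`0` size `0`; a degree bound `D ≥ |Γ|/2`; a truncation order `N₀ ≥ 2`; output degree
`m + 1 = 2p`; the kit's guard `(eα/κ²)·towerV D τ μ̄ < 1` at `τ := (e²(κ+ρ))²`.  Then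
`[door mixed graded sum over Ico 2 N₀] + 2·[door tail in normV μ̄] ≤ [Σ_{n∈Icc 2 (N₀−1)} e·Φ^{n−1}·ψ^p·towerSLip D τ ν̄ μ̄ n p] + 2·[ψ^p·e·towerV·(Φ·towerV)^{N₀−1}/(1−Φ·towerV)]`
with `Φ = eα/κ²`, `ψ = ρ⁻²` — the literal `hstep` right side of `towerLipStep_le_of_chernoff` / `towerBornDiff_le_law₄` with `Ct = 2`, `N = N₀ − 1`
(the source `src` is added by the caller). -/
theorem doorGradedLip_le_kitStepLip {Γ : Type*} [Fintype Γ] {κ ρ α : ℝ} (hκ : 0 < κ) (hρ : 0 < ρ) (hα : 0 ≤ α)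
    {Nμ Nν : ℕ → ℝ} (hNμ0 : ∀ m, 0 ≤ Nμ m) (hNμ00 : Nμ 0 = 0) (hNν0 : ∀ m, 0 ≤ Nν m) (hNν00 : Nν 0 = 0)
    {D : ℕ} (hD : Fintype.card Γ / 2 ≤ D) {N₀ : ℕ} (hN₀ : 2 ≤ N₀) {m p : ℕ} (hmp : m + 1 = 2 * p)
    (hguard : exp 1 * α / κ ^ 2 * towerV D ((exp 2 * (κ + ρ)) ^ 2) Nμ < 1) :
    (∑ n ∈ Ico 2 N₀, (ρ⁻¹ ^ (m + 1) * κ⁻¹ ^ (2 * (n - 1)) * (α ^ (n - 1) * exp n)) *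
        ∑ δ ∈ (Fintype.piFinset fun _ : Fin n => range (Fintype.card Γ / 2 + 1)) with m + 1 + 2 * (n - 1) ≤ ∑ a, 2 * δ a,
          ∑ a, (exp 2 * (κ + ρ)) ^ (2 * δ a) * Nν (δ a) * ∏ b ∈ univ.erase a, (exp 2 * (κ + ρ)) ^ (2 * δ b) * Nμ (δ b)) +
      2 * (ρ⁻¹ ^ (m + 1) * (exp 1 * normV Γ κ ρ Nμ) * (exp 1 * α * normV Γ κ ρ Nμ / κ ^ 2) ^ (N₀ - 1) /
        (1 - exp 1 * α * normV Γ κ ρ Nμ / κ ^ 2)) ≤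
    ∑ n ∈ Icc 2 (N₀ - 1), exp 1 * (exp 1 * α / κ ^ 2) ^ (n - 1) * (ρ⁻¹ ^ 2) ^ p *
        towerSLip D ((exp 2 * (κ + ρ)) ^ 2) Nν Nμ n p +
      2 * ((ρ⁻¹ ^ 2) ^ p * exp 1 * towerV D ((exp 2 * (κ + ρ)) ^ 2) Nμ *
        (exp 1 * α / κ ^ 2 * towerV D ((exp 2 * (κ + ρ)) ^ 2) Nμ) ^ (N₀ - 1) /
        (1 - exp 1 * α / κ ^ 2 * towerV D ((exp 2 * (κ + ρ)) ^ 2) Nμ)) := by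
  set τ := (exp 2 * (κ + ρ)) ^ 2 with hτ
  set Φ := exp 1 * α / κ ^ 2 with hΦ
  have hτ0 : 0 ≤ exp 2 * (κ + ρ) := mul_nonneg (exp_pos _).le (add_nonneg hκ.le hρ.le)
  have hΦ0 : 0 ≤ Φ := by rw [hΦ]; positivity
  have hIco : Ico 2 N₀ = Icc 2 (N₀ - 1) := by
    ext n; simp only [mem_Ico, mem_Icc]; omega
  refine add_le_add ?_ ?_
  · -- mixed graded part: order by order, EQUAL after enlarging the range
    rw [hIco]
    refine sum_le_sum fun n hn => ?_
    have hn1 : 1 ≤ n := by have := (mem_Icc.1 hn).1; omega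
    have hcoef : ρ⁻¹ ^ (m + 1) * κ⁻¹ ^ (2 * (n - 1)) * (α ^ (n - 1) * exp n) = exp 1 * Φ ^ (n - 1) * (ρ⁻¹ ^ 2) ^ p := by
      have h := door_coef_eq hκ.ne' (ρ := ρ) α p (n - 1)
      rw [show n - 1 + 1 = n by omega] at h
      rw [hmp, hΦ]
      exact h
    rw [hcoef]
    have hc0 : 0 ≤ exp 1 * Φ ^ (n - 1) * (ρ⁻¹ ^ 2) ^ p := by positivity
    refine mul_le_mul_of_nonneg_left ?_ hc0
    have hsub : ((Fintype.piFinset fun _ : Fin n => range (Fintype.card Γ / 2 + 1)).filter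
          fun δ : Fin n → ℕ => m + 1 + 2 * (n - 1) ≤ ∑ a, 2 * δ a) ⊆
        ((Fintype.piFinset fun _ : Fin n => range (D + 1)).filter fun δ : Fin n → ℕ => 2 * p + 2 * (n - 1) ≤ ∑ a, 2 * δ a) := by
      intro δ hδ
      rw [mem_filter, Fintype.mem_piFinset] at hδ ⊢
      exact ⟨fun a => mem_range.2 (lt_of_lt_of_le (mem_range.1 (hδ.1 a)) (by omega)), hmp ▸ hδ.2⟩
    have hterm0 : ∀ δ : Fin n → ℕ, 0 ≤ ∑ a, (exp 2 * (κ + ρ)) ^ (2 * δ a) * Nν (δ a) *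
        ∏ b ∈ univ.erase a, (exp 2 * (κ + ρ)) ^ (2 * δ b) * Nμ (δ b) :=
      fun δ => sum_nonneg fun a _ => mul_nonneg (mul_nonneg (pow_nonneg hτ0 _) (hNν0 _))
        (prod_nonneg fun b _ => mul_nonneg (pow_nonneg hτ0 _) (hNμ0 _))
    calc ∑ δ ∈ (Fintype.piFinset fun _ : Fin n => range (Fintype.card Γ / 2 + 1)) with m + 1 + 2 * (n - 1) ≤ ∑ a, 2 * δ a,
          ∑ a, (exp 2 * (κ + ρ)) ^ (2 * δ a) * Nν (δ a) * ∏ b ∈ univ.erase a, (exp 2 * (κ + ρ)) ^ (2 * δ b) * Nμ (δ b)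
        ≤ ∑ δ ∈ (Fintype.piFinset fun _ : Fin n => range (D + 1)) with 2 * p + 2 * (n - 1) ≤ ∑ a, 2 * δ a,
          ∑ a, (exp 2 * (κ + ρ)) ^ (2 * δ a) * Nν (δ a) * ∏ b ∈ univ.erase a, (exp 2 * (κ + ρ)) ^ (2 * δ b) * Nμ (δ b) :=
          sum_le_sum_of_subset_of_nonneg hsub fun δ _ _ => hterm0 δ
      _ = towerSLip D τ Nν Nμ n p := by
          rw [hτ]
          exact sum_range_filter_sum_pow_two_mul_eq_towerSLip hn1 (exp 2 * (κ + ρ)) hNν00 hNμ00 p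
  · -- tail: `normV ≤ towerV`, monotone tail, times `2`
    have hV := normV_le_towerV hκ.le hρ.le hNμ0 hNμ00 hD (κ := κ) (ρ := ρ)
    have hV0 : 0 ≤ normV Γ κ ρ Nμ := normV_nonneg hκ.le hρ.le hNμ0
    have hψ : 0 ≤ (ρ⁻¹ ^ 2) ^ p := by positivity
    have htail := geomTail_mono hΦ0 hV0 hV hguard (N₀ - 1)
    have hlhs : ρ⁻¹ ^ (m + 1) * (exp 1 * normV Γ κ ρ Nμ) * (exp 1 * α * normV Γ κ ρ Nμ / κ ^ 2) ^ (N₀ - 1) /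
          (1 - exp 1 * α * normV Γ κ ρ Nμ / κ ^ 2) =
        (ρ⁻¹ ^ 2) ^ p * (exp 1 * normV Γ κ ρ Nμ * (Φ * normV Γ κ ρ Nμ) ^ (N₀ - 1) / (1 - Φ * normV Γ κ ρ Nμ)) := by
      rw [hmp, pow_mul, hΦ]
      have : exp 1 * α * normV Γ κ ρ Nμ / κ ^ 2 = exp 1 * α / κ ^ 2 * normV Γ κ ρ Nμ := by ring
      rw [this]; ring
    have hrhs : (ρ⁻¹ ^ 2) ^ p * exp 1 * towerV D τ Nμ * (Φ * towerV D τ Nμ) ^ (N₀ - 1) / (1 - Φ * towerV D τ Nμ) =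
        (ρ⁻¹ ^ 2) ^ p * (exp 1 * towerV D τ Nμ * (Φ * towerV D τ Nμ) ^ (N₀ - 1) / (1 - Φ * towerV D τ Nμ)) := by ring
    rw [hlhs, hrhs]
    exact mul_le_mul_of_nonneg_left (mul_le_mul_of_nonneg_left htail hψ) zero_le_two

end Summit.HubbardSuperconductivity.HubbardSuperconductivity.Theorems.EngineV8

end
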